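import Mathlib

/-!
# Negative lemma for the crux `WeakHolomorphy` (stmt-CriticalPhenomena-11292, route `CardySusyWard`):
# the sublattice-staggered pairing of the BISECTOR-convention vertex observable telescopes

Supports (does not close) `Summit.CriticalPhenomena.CardyFormulaZ2.Theses.CardySusyWard.WeakHolomorphy`.
Source: the crux workfile `Cruxes/WeakHolomorphy/Disproof.lean` §C (cdisprove unit
`refuter-cdisprove-stmt-CriticalPhenomena-11292-0`).  Pure algebra, no probability.

Along a medial exploration path of `ℤ²` the visited medial vertices alternate between the two medial
sublattices (horizontal / vertical lattice edges); the winding on arrival at the `k`-th vertex is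
`w_k` quarter turns, `w_k = Σ_{j<k} ε_j` with turns `ε_j = ±1`, so `w_k ≡ k (mod 2)` and the
sublattice sign is `s_k = ± (-1)^{w_k}`; the tree's vertex phase (`MedialWinding.windingAt`, bisector
convention = winding on arrival plus half the turn; `passageSum … (1/3)`) is
`exp(-i(1/3)(w_k + ε_k/2)π/2) = exp(-iπ(2w_k + ε_k)/12)`.
`bisector_stagger_telescope`: `(-1)^w · exp(-iπ(2w+ε)/12) = (A(w) - A(w+ε))/(2cos(π/12))`,
`A(w) = exp(i·5πw/6)`, for `ε = ±1`; hence (`stagger_sum_bound`, Abel summation) for EVERY turn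
sequence and every weight sequence `g`,
`‖Σ_{k≤N} (-1)^{w_k} e^{-iπ(2w_k+ε_k)/12} g_k‖ ≤ (‖g_0‖ + ‖g_N‖ + Σ_{k<N}‖g_{k+1}-g_k‖)/(2cos(π/12))`,
independently of `N`.  Consequence ("negative knowledge" for the crux): the staggered pairing
`δ^{5/3} Σ_z s_z F^bis_δ(z) g(z_δ)` of the TREE's spin-`1/3` vertex observable against any Lipschitz
weight is `O(δ^{5/3}(‖g‖_∞ + δ‖∇g‖_∞ |γ|)) = O(δ^{2/3})` deterministically (`|γ| ≤ #darts = O(δ⁻²)`),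
so a reformulation "WeakHolomorphy ⇔ (staggered bisector pairing → 0)" is VACUOUS and a glue
"(staggered bisector pairing → 0) → WeakHolomorphy" is equivalent to the crux itself; the
crux-equivalent staggered statement (summation by parts of the Duminil-Copin 2012 Prop. 4 vertex
relation) has to be written with ENTRY phases / dart observables (the `A₂` Fourier mode of the four
corner classes, cf. `Theorems/CoherentMorera/Negative/KirchhoffModes.lean`).  Also recorded:
`bisector_entry_conversion`, the per-passage identity `e^{-iεπ/12} cos(π/12) = 1 - ½(1 - e^{-iεπ/6})`
behind `F^bis = F^ent/cos(π/12) - 2 sin(π/12)·(in - out)` (conversion between vertex conventions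
costs a Kirchhoff-defect term, negligible only against SMOOTH weights); and
`stagger_entry_phase_eq_spin_shift(')`: the staggered ENTRY phase is the entry phase of the shifted spin
`σ - 2` (at `σ = 1/3`: `-5/3`), which identifies the crux-equivalent staggered statement with the weak
invisibility of the spin-`(-5/3)` companion observable.
-/

noncomputable section

open Complex
open scoped Real

namespace Summit.CriticalPhenomena.CardyFormulaZ2.Theorems.WeakHolomorphy.Negative

/-- `(-1)^w = exp(iπw)` for an integer exponent. [folklore] -/
theorem neg_one_zpow_eq_cexp (w : ℤ) : (-1 : ℂ) ^ w = cexp (w * (π * I)) := by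
  rw [← Complex.exp_pi_mul_I, ← Complex.exp_int_mul]

/-- `2cos x = e^{ix} + e^{-ix}` in `ℂ`. [folklore] -/
theorem ofReal_two_mul_cos (x : ℝ) : ((2 * Real.cos x : ℝ) : ℂ) = cexp (x * I) + cexp (-(x * I)) := by
  push_cast
  rw [Complex.cos]
  rw [neg_mul]
  ring

/-- `cos(π/12) ≠ 0` (indeed `2cos(π/12) = (√6 + √2)/2 ≈ 1.93`). [folklore] -/
theorem cos_pi_div_twelve_ne_zero : Real.cos (π / 12) ≠ 0 :=
  (Real.cos_pos_of_mem_Ioo ⟨by linarith [Real.pi_pos], by linarith [Real.pi_pos]⟩).ne'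

/-- The scalar identity behind the telescoping, `ε = +1`: `e^{-iπ/12}·2cos(π/12) = 1 - e^{i5π/6}`. [folklore] -/
theorem stagger_key_pos :
    cexp (-(I * π / 12)) * ((2 * Real.cos (π / 12) : ℝ) : ℂ) = 1 - cexp (I * (5 * π / 6)) := by
  rw [ofReal_two_mul_cos, mul_add, ← Complex.exp_add, ← Complex.exp_add]
  have h1 : -(I * ↑π / 12) + ↑(π / 12 : ℝ) * I = 0 := by push_cast; ring
  have h2 : -(I * ↑π / 12) + -(↑(π / 12 : ℝ) * I) = -(I * π / 6) := by push_cast; ring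
  have h3 : I * (5 * ↑π / 6) = ↑π * I + -(I * π / 6) := by ring
  rw [h1, h2, h3, Complex.exp_zero, Complex.exp_add, Complex.exp_pi_mul_I]
  ring

/-- The scalar identity behind the telescoping, `ε = -1`: `e^{iπ/12}·2cos(π/12) = 1 - e^{-i5π/6}`. [folklore] -/
theorem stagger_key_neg :
    cexp (I * π / 12) * ((2 * Real.cos (π / 12) : ℝ) : ℂ) = 1 - cexp (-(I * (5 * π / 6))) := by
  rw [ofReal_two_mul_cos, mul_add, ← Complex.exp_add, ← Complex.exp_add]
  have h1 : I * ↑π / 12 + ↑(π / 12 : ℝ) * I = I * π / 6 := by push_cast; ring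
  have h2 : I * ↑π / 12 + -(↑(π / 12 : ℝ) * I) = 0 := by push_cast; ring
  have h3 : -(I * (5 * ↑π / 6)) = -(↑π * I) + I * π / 6 := by ring
  rw [h1, h2, h3, Complex.exp_zero, Complex.exp_add, Complex.exp_neg, Complex.exp_pi_mul_I]
  ring

/-- **Telescoping of the staggered bisector phase** (pathwise algebra, no probability): for an
integer winding count `w` (quarter turns on arrival) and a turn `ε = ±1`,
`(-1)^w · exp(-iπ(2w + ε)/12) = (A(w) - A(w + ε)) / (2cos(π/12))` with `A(w) = exp(i·5πw/6)`.  Along a medial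
path `w_{k+1} = w_k + ε_k` and the sublattice sign is `± (-1)^{w_k}`, so the staggered sum of the
bisector-convention phases `exp(-i(1/3)(W_k + ε_kπ/4))` against any weight is an Abel sum of
differences of `A` (module docstring). [folklore] -/
theorem bisector_stagger_telescope (w ε : ℤ) (hε : ε = 1 ∨ ε = -1) :
    (-1 : ℂ) ^ w * cexp (-(I * (π * (2 * w + ε) / 12))) =
      (cexp (I * (5 * π * ((w : ℤ) : ℂ) / 6)) - cexp (I * (5 * π * ((w + ε : ℤ) : ℂ) / 6))) / ((2 * Real.cos (π / 12) : ℝ) : ℂ) := by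
  have hc : ((2 * Real.cos (π / 12) : ℝ) : ℂ) ≠ 0 := by
    exact_mod_cast mul_ne_zero two_ne_zero cos_pi_div_twelve_ne_zero
  rw [eq_div_iff hc, neg_one_zpow_eq_cexp, ← Complex.exp_add]
  have hA : cexp (I * (5 * π * ((w + ε : ℤ) : ℂ) / 6)) = cexp (I * (5 * π * ((w : ℤ) : ℂ) / 6)) * cexp (I * (5 * π * ε / 6)) := by
    rw [← Complex.exp_add]; congr 1; push_cast; ring
  rcases hε with rfl | rfl
  · have harg : (w : ℂ) * (↑π * I) + -(I * (↑π * (2 * ↑w + ((1 : ℤ) : ℂ)) / 12)) =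
        I * (5 * π * w / 6) + -(I * π / 12) := by push_cast; ring
    rw [harg, Complex.exp_add, hA, mul_assoc, stagger_key_pos]
    push_cast; ring
  · have harg : (w : ℂ) * (↑π * I) + -(I * (↑π * (2 * ↑w + ((-1 : ℤ) : ℂ)) / 12)) =
        I * (5 * π * w / 6) + I * π / 12 := by push_cast; ring
    rw [harg, Complex.exp_add, hA, mul_assoc, stagger_key_neg]
    push_cast; ring_nf

/-- `‖A(w)‖ = 1`. [folklore] -/
theorem norm_stagPhase (w : ℤ) : ‖cexp (I * (5 * π * ((w : ℤ) : ℂ) / 6))‖ = 1 := by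
  rw [show I * (5 * ↑π * ↑w / 6) = ((5 * π * w / 6 : ℝ) : ℂ) * I by push_cast; ring]
  exact Complex.norm_exp_ofReal_mul_I _

/-- Abel summation of a telescoping sum (pure algebra). [folklore] -/
theorem abel_identity (A g : ℕ → ℂ) (N : ℕ) :
    ∑ k ∈ Finset.range (N + 1), (A k - A (k + 1)) * g k =
      A 0 * g 0 - A (N + 1) * g N + ∑ k ∈ Finset.range N, A (k + 1) * (g (k + 1) - g k) := by
  induction N with
  | zero => simp; ring
  | succ n ih => rw [Finset.sum_range_succ, ih, Finset.sum_range_succ]; ring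

/-- Abel bound: a telescoping sum against weights `g` with unimodular-bounded `A` is controlled by the
total variation of `g` plus two boundary terms — NOT by the number of terms. [folklore] -/
theorem abel_bound (A g : ℕ → ℂ) (hA : ∀ k, ‖A k‖ ≤ 1) (N : ℕ) :
    ‖∑ k ∈ Finset.range (N + 1), (A k - A (k + 1)) * g k‖ ≤
      ‖g 0‖ + ‖g N‖ + ∑ k ∈ Finset.range N, ‖g (k + 1) - g k‖ := by
  rw [abel_identity]
  have h1 : ‖A 0 * g 0‖ ≤ ‖g 0‖ := by
    rw [norm_mul]; exact mul_le_of_le_one_left (norm_nonneg _) (hA 0)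
  have h2 : ‖A (N + 1) * g N‖ ≤ ‖g N‖ := by
    rw [norm_mul]; exact mul_le_of_le_one_left (norm_nonneg _) (hA (N + 1))
  have h3 : ‖∑ k ∈ Finset.range N, A (k + 1) * (g (k + 1) - g k)‖ ≤
      ∑ k ∈ Finset.range N, ‖g (k + 1) - g k‖ := by
    refine (norm_sum_le _ _).trans (Finset.sum_le_sum fun k _ => ?_)
    rw [norm_mul]; exact mul_le_of_le_one_left (norm_nonneg _) (hA (k + 1))
  calc ‖A 0 * g 0 - A (N + 1) * g N + ∑ k ∈ Finset.range N, A (k + 1) * (g (k + 1) - g k)‖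
      ≤ ‖A 0 * g 0 - A (N + 1) * g N‖ + ‖∑ k ∈ Finset.range N, A (k + 1) * (g (k + 1) - g k)‖ :=
        norm_add_le _ _
    _ ≤ (‖A 0 * g 0‖ + ‖A (N + 1) * g N‖) + ∑ k ∈ Finset.range N, ‖g (k + 1) - g k‖ :=
        add_le_add (norm_sub_le _ _) h3
    _ ≤ ‖g 0‖ + ‖g N‖ + ∑ k ∈ Finset.range N, ‖g (k + 1) - g k‖ := by linarith

/-- **Pathwise bound for the staggered bisector sum.** For ANY sequence of turns `ε_k = ±1` (winding
counts `w_k = Σ_{j<k} ε_j`) and any weights `g_k`, the staggered sum of bisector phases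
`Σ_{k ≤ N} (-1)^{w_k} e^{-iπ(2w_k+ε_k)/12} g_k` is bounded by
`(‖g_0‖ + ‖g_N‖ + Σ_{k<N} ‖g_{k+1} - g_k‖) / (2cos(π/12))`, independently of `N`.  Applied to the
medial exploration (`w_k` = quarter turns on arrival, sublattice sign `s_k = ±(-1)^{w_k}`,
`g_k = ∂φ(z_k)` Lipschitz at scale `δ`): `|Σ_z s_z passageSum-phases · g| ≤ C(‖g‖_∞ + δ‖∇g‖_∞ |γ|)`,
so `δ^{5/3}·(staggered bisector pairing) = O(δ^{2/3})` deterministically (§C docstring). [folklore] -/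
theorem stagger_sum_bound (ε : ℕ → ℤ) (hε : ∀ k, ε k = 1 ∨ ε k = -1) (g : ℕ → ℂ) (N : ℕ) :
    ‖∑ k ∈ Finset.range (N + 1),
        (-1 : ℂ) ^ (∑ j ∈ Finset.range k, ε j) * cexp (-(I * (π * (2 * (∑ j ∈ Finset.range k, ε j) + ε k) / 12))) * g k‖ ≤
      (‖g 0‖ + ‖g N‖ + ∑ k ∈ Finset.range N, ‖g (k + 1) - g k‖) / (2 * Real.cos (π / 12)) := by
  have hc : 0 < 2 * Real.cos (π / 12) :=
    mul_pos two_pos (Real.cos_pos_of_mem_Ioo ⟨by linarith [Real.pi_pos], by linarith [Real.pi_pos]⟩)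
  have hterm : ∀ k, (-1 : ℂ) ^ (∑ j ∈ Finset.range k, ε j) * cexp (-(I * (π * (2 * (∑ j ∈ Finset.range k, ε j) + ε k) / 12))) * g k
      = ((cexp (I * (5 * π * ((∑ j ∈ Finset.range k, ε j : ℤ) : ℂ) / 6)) - cexp (I * (5 * π * ((∑ j ∈ Finset.range (k + 1), ε j : ℤ) : ℂ) / 6))) * g k) / ((2 * Real.cos (π / 12) : ℝ) : ℂ) := by
    intro k
    rw [bisector_stagger_telescope _ _ (hε k), Finset.sum_range_succ]
    ring
  simp_rw [hterm, ← Finset.sum_div, norm_div]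
  have hnorm : ‖((2 * Real.cos (π / 12) : ℝ) : ℂ)‖ = 2 * Real.cos (π / 12) := by
    rw [Complex.norm_real, Real.norm_eq_abs, abs_of_pos hc]
  rw [hnorm, div_le_div_iff_of_pos_right hc]
  exact abel_bound (fun k => cexp (I * (5 * π * ((∑ j ∈ Finset.range k, ε j : ℤ) : ℂ) / 6))) g (fun k => (norm_stagPhase _).le) N

/-- **Entry ↔ bisector conversion, per passage** (the algebra of §D step 4): for a turn `ε = ±1`,
`e^{-iεπ/12} = 1/cos(π/12) - 2 sin(π/12)·(1 - e^{-iεπ/6})`, i.e. `P^bis = P^ent/cos(π/12) - 2sin(π/12)·D`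
with `D = P^ent - P^out = P^ent(1 - e^{-iεπ/6})` the in-minus-out flux of the passage; uses only
`2 sin(π/12) cos(π/12) = sin(π/6) = 1/2`. [folklore] -/
theorem bisector_entry_conversion (ε : ℤ) (hε : ε = 1 ∨ ε = -1) :
    cexp (-(I * (π * ε / 12))) * (Real.cos (π / 12) : ℂ) =
      1 - 2 * (Real.sin (π / 12) : ℂ) * (Real.cos (π / 12) : ℂ) * (1 - cexp (-(I * (π * ε / 6)))) := by
  -- 2 sin(π/12) cos(π/12) = sin(π/6) = 1/2, in ℂ
  have hsc : 2 * (Real.sin (π / 12) : ℂ) * (Real.cos (π / 12) : ℂ) = 1 / 2 := by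
    rw [Complex.ofReal_sin, Complex.ofReal_cos, ← Complex.sin_two_mul,
      show (2 : ℂ) * ((π / 12 : ℝ) : ℂ) = ((π / 6 : ℝ) : ℂ) by push_cast; ring,
      ← Complex.ofReal_sin, Real.sin_pi_div_six]
    push_cast
    ring
  rw [hsc]
  -- cos(π/12) = (u + u⁻¹)/2 with u = e^{iπ/12}
  have hcos : (Real.cos (π / 12) : ℂ) = (cexp (↑(π / 12 : ℝ) * I) + cexp (-(↑(π / 12 : ℝ) * I))) / 2 := by
    have := ofReal_two_mul_cos (π / 12)
    push_cast at this ⊢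
    linear_combination this / 2
  rw [hcos]
  rcases hε with rfl | rfl
  · have e1 : -(I * (↑π * ((1:ℤ):ℂ) / 12)) + ↑(π / 12 : ℝ) * I = 0 := by push_cast; ring
    have e2 : -(I * (↑π * ((1:ℤ):ℂ) / 12)) + -(↑(π / 12 : ℝ) * I) = -(I * (↑π * ((1:ℤ):ℂ) / 6)) := by
      push_cast; ring
    rw [mul_div_assoc', mul_add, ← Complex.exp_add, ← Complex.exp_add, e1, e2, Complex.exp_zero]
    ring
  · have e1 : -(I * (↑π * ((-1:ℤ):ℂ) / 12)) + ↑(π / 12 : ℝ) * I = -(I * (↑π * ((-1:ℤ):ℂ) / 6)) := by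
      push_cast; ring
    have e2 : -(I * (↑π * ((-1:ℤ):ℂ) / 12)) + -(↑(π / 12 : ℝ) * I) = 0 := by push_cast; ring
    rw [mul_div_assoc', mul_add, ← Complex.exp_add, ← Complex.exp_add, e1, e2, Complex.exp_zero]
    ring

/-- **The staggered entry phase is the spin-`(σ-2)` entry phase**: `(-1)^w e^{-iσπw/2} = e^{-i(σ-2)πw/2}`,
here at `σ = 1/3`: `(-1)^w e^{-iπw/6} = e^{i5πw/6}` (= `A(w)` above).  Along a medial path the
sublattice sign is `±(-1)^{w_k}`, so the sublattice-staggered ENTRY-convention pairing — the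
crux-equivalent `A₂`-mode statement of `Cruxes/WeakHolomorphy/Disproof.lean` §D — is literally the
`δ^{5/3}`-normalised pairing of Smirnov's entry observable with the shifted spin `1/3 - 2 = -5/3` on the
same exploration path; the Coulomb-gas dimension of that two-arm field, `1/4 + 3s²/4 = 7/3 > 2` at
`s = -5/3`, is the heuristic reason the crux quantity decays like `δ²` relative (ibid.). [folklore] -/
theorem stagger_entry_phase_eq_spin_shift (w : ℤ) :
    (-1 : ℂ) ^ w * cexp (-(I * (π * w / 6))) = cexp (I * (5 * π * ((w : ℤ) : ℂ) / 6)) := by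
  rw [neg_one_zpow_eq_cexp, ← Complex.exp_add]
  congr 1
  ring

/-- The same identity for a general spin `σ`: `(-1)^w e^{-iσ(π/2)w} = e^{-i(σ-2)(π/2)w}`. [folklore] -/
theorem stagger_entry_phase_eq_spin_shift' (σ : ℝ) (w : ℤ) :
    (-1 : ℂ) ^ w * cexp (-(I * σ * (π / 2) * w)) = cexp (-(I * (σ - 2) * (π / 2) * w)) := by
  rw [neg_one_zpow_eq_cexp, ← Complex.exp_add]
  congr 1
  ring

end Summit.CriticalPhenomena.CardyFormulaZ2.Theorems.WeakHolomorphy.Negative
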